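import Summits.QuantumFields.BalabanUV.T4Continuum.Support.OutputRateOpGaussianMargin

/-!
# OutputRateOpGaussianParamMargin — the three ARITHMETIC inputs of the parametrised Gaussian hook, as lemmas: the margin UNIFORM IN THE
# CONTOUR PARAMETER from the base margin by TWO displacements (σ-coupling + operator datum), the insertion GROWTH from potential budgets,
# and the Cauchy WEIGHT bound on the circles
# (cell `pub-balaban`, T⁴ fan-out, `HOME/BINDER-OWNERS.md` row NE5, owner lineage t4-ne5-p1, gen 29, route P1)

HONEST FRAMING (T4-DAG PAGE 1).  Rung (B)+1 on ONE finite four-torus — NOT infinite volume, NOT a mass gap, NOT the Clay problem;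
`FlowStep.BetaPertH`, (B), (B^μ) do not occur here.  NE5 is NOT PRINTED and NOT PROVED (spine 0/9).  Nothing of Bałaban's series is asserted;
0 cite tags.  The located print (quoted verbatim in the lineage's loci sheet `b13-loci.md` and the leaf `T4InputCauchyRateData` §11): [II] =
[Balaban1988RG2Cluster] p. 15 (2.14) (the resummed term: Cauchy kernels `(2πi)⁻¹(σ(Δ) − s(Δ))⁻²dσ(Δ)`, `(2πi)⁻¹(τ(Y) − t(Y))⁻²dτ(Y)` on circles,
interpolation parameters `s, t ∈ [0, 1]`, two Gaussian integrals with operators at `(Z₀, σ(Z))`, the factor `exp[Σ τ(Y)𝐕_k(Y,B)]`), p. 15 (2.15)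
(«we replace the operators by the corresponding operators with σ(Z) = 0, 𝐔 = U, 𝐉 = 0, and we estimate the error»), p. 16 (2.16)/(2.21) (kernel
bounds of the replacement errors `R₁`, `R₂`), p. 16 (2.18) (the radii `1/|τ(Y)|`), p. 5 (the circles `|s(Y₀)| ≤ e^{κ₁}`).  HONEST DEPENDENCY (cell,
verbatim): continuum YM on T⁴ ⇐ BetaPertH ∧ nine spine estimates (0/9 proved); BetaPertH ⇐ (D1) ∧ (D4) ∧ CAP+tail; G-an2-4 gates asym, D1 and
NE2/3/4.

WHAT THIS MODULE IS.  `OutputRateOpGaussianParam` (this gen) reduced W2-op for (2.14)-SHAPED terms to the dictionary plus three inputs, each an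
inequality among letters.  Here the three are lemmas of their natural shape, so that an instancer (the swarm's O1-d2-ii) only exhibits letters:
* §1 **`re_ge_of_baseMargin_param_lipschitz`** — MARGIN UNIFORM IN THE PARAMETER: base margin `Re q₀(v) ≥ m₀N(v)` at the DECOUPLED base point
  (`σ(Z) = 0`, base operator datum `c`: `OutputRateOpGaussianMargin.written_exponent_margin`), σ-COUPLING displacement `‖q(c, p, v) − q₀(v)‖ ≤ m₂N(v)`
  uniform in `p` (printed KIND: (2.15)–(2.17)/(2.21), the replacement errors are small), OPERATOR displacement `‖q(o, p, v) − q(c, p, v)‖ ≤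
  m₁‖o − c‖N(v)` (W1's reach) ⟹ `Re q(o, p, v) ≥ (m₀ − m₂ − m₁R′)N(v)` on `ball c R′` for every `p` — the margin survives iff `m₂ + m₁R′ < m₀`,
  ARITHMETIC; `re_ge_shift_of_baseMargin_param_lipschitz` — the same with a `v`-independent part `b` (the affine margin `m·N(v) − b` of
  `TermOpGaussianParam`).
* §2 **`norm_mul_cexp_sum_le_growth`** — INSERTION GROWTH: a bounded prefactor (characteristic functions, `‖F₀ v‖ ≤ F`) times
  `exp[Σ_{Y∈D} τ(Y)V(Y, v)]` with potential budgets `‖V(Y, v)‖ ≤ c_Y + d_Y‖v‖²` has `‖·‖ ≤ F·e^{Σ‖τ(Y)‖c_Y}·e^{(Σ‖τ(Y)‖d_Y)‖v‖²}`; with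
  `Σ‖τ(Y)‖d_Y ≤ m/2` this is the growth clause `≤ G₀e^{(m/2)‖v‖²}`, `G₀ = F·e^{Σ‖τ(Y)‖c_Y}` (`norm_insertion_le_of_budget`).
* §3 **`norm_inv_sq_sub_le_of_circle`** — CAUCHY WEIGHTS: for `|τ| = r > 1 ≥ t ≥ 0`, `‖((τ − t)²)⁻¹‖ ≤ ((r − 1)²)⁻¹`; finite products
  (`norm_prod_inv_sq_sub_le`) — the bound `‖w(p)‖ ≤ w₀` of the hook with `w₀ = Π (2π)⁻¹(r − 1)⁻²`-type letters.

STATUS (census).  Arithmetic/bookkeeping only; no wall is discharged from print; NE5 NOT PROVED; 0/12 leaves on Bałaban's concrete objects; spine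
0/9; rung (B)+1 finite T⁴; NOT infinite volume / mass gap / Clay.  0 sorry; axioms ⊆ {propext, Classical.choice, Quot.sound}.
-/

noncomputable section

open Set Metric Finset

namespace Summit.QuantumFields.BalabanUV.T4Continuum.OutputRateOpGaussianParamMargin

open Summit.QuantumFields.BalabanUV.T4Continuum.OutputRateOpGaussianMargin

/-! ## §1 The margin uniform in the contour parameter: two displacements off the decoupled base point -/

section Margin

variable {P V : Type*} {Op : Type*} [NormedAddCommGroup Op]

/-- **BASE MARGIN + σ-COUPLING DISPLACEMENT + OPERATOR DISPLACEMENT ⟹ MARGIN ON THE BALL, UNIFORM IN THE PARAMETER**: if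
`Re q₀(v) ≥ m₀·N(v)` (decoupled base point at the base operator datum `c`), `‖q(c, p, v) − q₀(v)‖ ≤ m₂·N(v)` for every parameter `p`, and
`‖q(o, p, v) − q(c, p, v)‖ ≤ m₁‖o − c‖·N(v)`, then on `ball c R′`, for every `p`, `Re q(o, p, v) ≥ (m₀ − m₂ − m₁R′)·N(v)` (`N ≥ 0` any weight).
The margin survives iff `m₂ + m₁R′ < m₀` — ARITHMETIC. [folklore] -/
theorem re_ge_of_baseMargin_param_lipschitz {q : Op → P → V → ℂ} {q₀ : V → ℂ} {c : Op} {m₀ m₁ m₂ R' : ℝ} {N : V → ℝ}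
    (hN : ∀ v, 0 ≤ N v) (hm₁ : 0 ≤ m₁) (hbase : ∀ v, m₀ * N v ≤ (q₀ v).re) (hpar : ∀ p v, ‖q c p v - q₀ v‖ ≤ m₂ * N v)
    (hlip : ∀ o p v, ‖q o p v - q c p v‖ ≤ m₁ * ‖o - c‖ * N v) {o : Op} (ho : o ∈ ball c R') (p : P) (v : V) :
    (m₀ - m₂ - m₁ * R') * N v ≤ (q o p v).re := by
  have hbase' : ∀ v, (m₀ - m₂) * N v ≤ (q c p v).re := fun v => by
    have h2 : -(m₂ * N v) ≤ (q c p v - q₀ v).re :=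
      (neg_le_neg (hpar p v)).trans (abs_le.1 (Complex.abs_re_le_norm _)).1
    rw [Complex.sub_re] at h2
    nlinarith [hbase v]
  have h := re_ge_of_baseMargin_lipschitz (q := fun o v => q o p v) hN hm₁ hbase' (fun o v => hlip o p v) ho v
  simpa [sub_sub] using h

/-- The same with a `v`-INDEPENDENT part: if the base exponent has `Re q₀(v) ≥ m₀·N(v) − b`, then on the ball
`Re q(o, p, v) ≥ (m₀ − m₂ − m₁R′)·N(v) − b` — the AFFINE margin clause of `OutputRateOpGaussianParam.TermOpGaussianParam` (with `N = ‖·‖²`).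
[folklore] -/
theorem re_ge_shift_of_baseMargin_param_lipschitz {q : Op → P → V → ℂ} {q₀ : V → ℂ} {c : Op} {m₀ m₁ m₂ R' b : ℝ} {N : V → ℝ}
    (hN : ∀ v, 0 ≤ N v) (hm₁ : 0 ≤ m₁) (hbase : ∀ v, m₀ * N v - b ≤ (q₀ v).re) (hpar : ∀ p v, ‖q c p v - q₀ v‖ ≤ m₂ * N v)
    (hlip : ∀ o p v, ‖q o p v - q c p v‖ ≤ m₁ * ‖o - c‖ * N v) {o : Op} (ho : o ∈ ball c R') (p : P) (v : V) :
    (m₀ - m₂ - m₁ * R') * N v - b ≤ (q o p v).re := by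
  rw [mem_ball, dist_eq_norm] at ho
  have hpar' : -(m₂ * N v) ≤ (q c p v - q₀ v).re :=
    (neg_le_neg (hpar p v)).trans (abs_le.1 (Complex.abs_re_le_norm _)).1
  have h1 : ‖q o p v - q c p v‖ ≤ m₁ * R' * N v :=
    (hlip o p v).trans (mul_le_mul_of_nonneg_right (mul_le_mul_of_nonneg_left ho.le hm₁) (hN v))
  have h2 : -(m₁ * R' * N v) ≤ (q o p v - q c p v).re := (neg_le_neg h1).trans (abs_le.1 (Complex.abs_re_le_norm _)).1
  rw [Complex.sub_re] at hpar' h2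
  nlinarith [hbase v]

end Margin

/-! ## §2 The insertion growth from potential budgets -/

section Growth

variable {𝒴 V : Type*}

/-- **INSERTION GROWTH**: a bounded prefactor times `exp[Σ_{Y∈D} τ(Y)·V(Y, v)]` with budgets `‖V(Y, v)‖ ≤ c_Y + d_Y‖v‖²` obeys `‖F₀(v)·exp[Σ τ(Y)V(Y,v)]‖ ≤ F·e^{Σ‖τ(Y)‖c_Y}·e^{(Σ‖τ(Y)‖d_Y)·‖v‖²}`. [folklore] -/
theorem norm_mul_cexp_sum_le_growth [NormedAddCommGroup V] (D : Finset 𝒴) {F₀ : V → ℂ} {τ : 𝒴 → ℂ} {Vf : 𝒴 → V → ℂ} {F : ℝ}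
    {c d : 𝒴 → ℝ} (hF : ∀ v, ‖F₀ v‖ ≤ F) (hV : ∀ Y ∈ D, ∀ v, ‖Vf Y v‖ ≤ c Y + d Y * ‖v‖ ^ 2) (v : V) :
    ‖F₀ v * Complex.exp (∑ Y ∈ D, τ Y * Vf Y v)‖ ≤
      F * Real.exp (∑ Y ∈ D, ‖τ Y‖ * c Y) * Real.exp ((∑ Y ∈ D, ‖τ Y‖ * d Y) * ‖v‖ ^ 2) := by
  have hF0 : 0 ≤ F := (norm_nonneg _).trans (hF v)
  have hsum : ‖∑ Y ∈ D, τ Y * Vf Y v‖ ≤ ∑ Y ∈ D, ‖τ Y‖ * c Y + (∑ Y ∈ D, ‖τ Y‖ * d Y) * ‖v‖ ^ 2 := by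
    calc ‖∑ Y ∈ D, τ Y * Vf Y v‖ ≤ ∑ Y ∈ D, ‖τ Y * Vf Y v‖ := norm_sum_le _ _
      _ ≤ ∑ Y ∈ D, (‖τ Y‖ * c Y + ‖τ Y‖ * d Y * ‖v‖ ^ 2) := sum_le_sum fun Y hY => by
          rw [norm_mul]
          calc ‖τ Y‖ * ‖Vf Y v‖ ≤ ‖τ Y‖ * (c Y + d Y * ‖v‖ ^ 2) :=
                mul_le_mul_of_nonneg_left (hV Y hY v) (norm_nonneg _)
            _ = ‖τ Y‖ * c Y + ‖τ Y‖ * d Y * ‖v‖ ^ 2 := by ring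
      _ = ∑ Y ∈ D, ‖τ Y‖ * c Y + (∑ Y ∈ D, ‖τ Y‖ * d Y) * ‖v‖ ^ 2 := by
          rw [sum_add_distrib, sum_mul]
  have hexp : ‖Complex.exp (∑ Y ∈ D, τ Y * Vf Y v)‖ ≤ Real.exp ‖∑ Y ∈ D, τ Y * Vf Y v‖ := by
    rw [Complex.norm_exp]; exact Real.exp_le_exp.2 (Complex.re_le_norm _)
  rw [norm_mul, mul_assoc, ← Real.exp_add]
  exact mul_le_mul (hF v) (hexp.trans (Real.exp_le_exp.2 hsum)) (norm_nonneg _) hF0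

/-- Hence the GROWTH CLAUSE of the Gaussian hooks: if moreover `Σ‖τ(Y)‖d_Y ≤ m/2`, then
`‖F₀(v)·exp[Σ τ(Y)V(Y,v)]‖ ≤ G₀·e^{(m/2)‖v‖²}` with `G₀ = F·e^{Σ‖τ(Y)‖c_Y}` — an ARITHMETIC smallness of the radii `|τ(Y)|` against the
quadratic budgets (printed KIND: (2.18) chooses `1/|τ(Y)|` large against the (1.36)/(1.43) bounds). [folklore] -/
theorem norm_insertion_le_of_budget [NormedAddCommGroup V] (D : Finset 𝒴) {F₀ : V → ℂ} {τ : 𝒴 → ℂ} {Vf : 𝒴 → V → ℂ} {F m : ℝ}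
    {c d : 𝒴 → ℝ} (hF : ∀ v, ‖F₀ v‖ ≤ F) (hV : ∀ Y ∈ D, ∀ v, ‖Vf Y v‖ ≤ c Y + d Y * ‖v‖ ^ 2)
    (hsmall : ∑ Y ∈ D, ‖τ Y‖ * d Y ≤ m / 2) (v : V) :
    ‖F₀ v * Complex.exp (∑ Y ∈ D, τ Y * Vf Y v)‖ ≤ F * Real.exp (∑ Y ∈ D, ‖τ Y‖ * c Y) * Real.exp (m / 2 * ‖v‖ ^ 2) := by
  have hF0 : 0 ≤ F := (norm_nonneg _).trans (hF v)
  refine (norm_mul_cexp_sum_le_growth D hF hV v).trans ?_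
  exact mul_le_mul_of_nonneg_left (Real.exp_le_exp.2 (mul_le_mul_of_nonneg_right hsmall (sq_nonneg _)))
    (mul_nonneg hF0 (Real.exp_pos _).le)

end Growth

/-! ## §3 The Cauchy weights on the circles -/

section Cauchy

/-- **THE CAUCHY KERNEL ON THE CIRCLE**: for `‖τ‖ = r`, `1 < r` and `0 ≤ t ≤ 1` (interpolation parameter inside, contour outside the unit disc),
`‖τ − t‖ ≥ r − 1`, hence `‖((τ − t)²)⁻¹‖ ≤ ((r − 1)²)⁻¹`. [folklore] -/
theorem norm_inv_sq_sub_le_of_circle {τ : ℂ} {t r : ℝ} (hτ : ‖τ‖ = r) (hr : 1 < r) (ht0 : 0 ≤ t) (ht1 : t ≤ 1) :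
    ‖((τ - (t : ℂ)) ^ 2)⁻¹‖ ≤ ((r - 1) ^ 2)⁻¹ := by
  have hdist : r - 1 ≤ ‖τ - (t : ℂ)‖ := by
    have h1 : ‖τ‖ - ‖(t : ℂ)‖ ≤ ‖τ - (t : ℂ)‖ := norm_sub_norm_le _ _
    have h2 : ‖(t : ℂ)‖ = t := by rw [Complex.norm_real, Real.norm_eq_abs, abs_of_nonneg ht0]
    rw [hτ, h2] at h1
    linarith
  have hpos : 0 < (r - 1) ^ 2 := by positivity
  rw [norm_inv, norm_pow]
  exact inv_anti₀ hpos (pow_le_pow_left₀ (by linarith) hdist 2)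

/-- Finite PRODUCTS of such kernels (one factor per cube `Δ` and per polymer `Y` of (2.14)): if every factor obeys `‖k i‖ ≤ K i` with `0 ≤ ‖k i‖`,
then `‖Π k i‖ ≤ Π K i` — the weight bound `‖w(p)‖ ≤ w₀` of `TermOpGaussianParam` with `w₀` a product of `(2π)⁻¹(r − 1)⁻²`-type letters. [folklore] -/
theorem norm_prod_le_prod_of_le {ι : Type*} (s : Finset ι) {k : ι → ℂ} {K : ι → ℝ} (hk : ∀ i ∈ s, ‖k i‖ ≤ K i) :
    ‖∏ i ∈ s, k i‖ ≤ ∏ i ∈ s, K i := by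
  rw [norm_prod]
  exact prod_le_prod (fun i _ => norm_nonneg _) hk

/-- The (2.14) Cauchy weight of ONE contour variable, `(2πi)⁻¹·((τ − t)²)⁻¹`, is bounded by `(2π)⁻¹((r − 1)²)⁻¹` on the circle `‖τ‖ = r > 1`,
`t ∈ [0, 1]`. [folklore] -/
theorem norm_cauchyWeight_le {τ : ℂ} {t r : ℝ} (hτ : ‖τ‖ = r) (hr : 1 < r) (ht0 : 0 ≤ t) (ht1 : t ≤ 1) :
    ‖(2 * Real.pi * Complex.I)⁻¹ * ((τ - (t : ℂ)) ^ 2)⁻¹‖ ≤ (2 * Real.pi)⁻¹ * ((r - 1) ^ 2)⁻¹ := by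
  rw [norm_mul]
  have h2pi : ‖(2 * Real.pi * Complex.I : ℂ)⁻¹‖ = (2 * Real.pi)⁻¹ := by
    rw [norm_inv, norm_mul, Complex.norm_I, mul_one]
    norm_cast
    rw [Real.norm_eq_abs, abs_of_pos (by positivity)]
  rw [h2pi]
  exact mul_le_mul_of_nonneg_left (norm_inv_sq_sub_le_of_circle hτ hr ht0 ht1) (by positivity)

end Cauchy

end Summit.QuantumFields.BalabanUV.T4Continuum.OutputRateOpGaussianParamMargin

end
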